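import Summits.QuantumFields.GaugeBoot.SquarePositiveRealisable
import Summits.QuantumFields.GaugeBoot.GaugeOrbitPolynomials
import HarnessLib

/-!
# Positivity ⇒ realisability: square-positive functionals on the polynomial observables are probability measures (gauge-boot, L1 supplement)

HONEST FRAMING (cell `pub-gaugeboot`, page 1 of every file): the venture produces certified bounds
on lattice expectations at stated coupling, gauge group, dimension and torus size; NOT a mass gap,
NOT a continuum limit, NOT a string tension; NOT Yang–Mills-summit-bearing (barriers
`FixedCouplingUltralocality`, `PerturbativeInvisibility`). Structural; it certifies no number.

## Content

The variables of a lattice bootstrap are putative expectation values of POLYNOMIAL observables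
(Wilson loops, open strings: `polyAlgebra r`, `PolynomialObservables.lean`), constrained by
positive semi-definiteness of moment matrices — i.e. by SQUARE-POSITIVITY `0 ≤ φ (a a)` of the
linear functional `φ` they define — and by the loop equations. This file removes the
"realisability by a probability measure" hypothesis from the completeness theorems of
`PolynomialSchwingerDyson.lean` / `AbelianPolynomialLoopEquations.lean`: for configurations
`ι → G` of ANY compact matrix group `G` (faithful unitary `r : LatticeRep G`), `ι` countable,

* `isTranslationFinite_polyAlgebra` — every polynomial observable lies in a finite-dimensional
  subspace of polynomials stable under all two-sided translations `U ↦ z⁻¹ U w` (words of bounded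
  length; `GaugeOrbitPolynomials.exists_fg_invariant_of_local`);
* ★★★ `exists_probabilityMeasure_of_sqPositive_poly` — a linear functional on `C(ι → G, ℝ)` with
  `φ 1 = 1` and `0 ≤ φ (a a)` for all polynomial `a` agrees ON ALL POLYNOMIAL OBSERVABLES with a
  unique (`eq_of_forall_integral_poly_eq`) Borel probability measure; `…_poly_sub` — the same for
  a functional given only on the polynomials; ★★ `abs_le_norm_of_sqPositive_poly`,
  `le_of_sqPositive_poly` — `inf a ≤ φ a ≤ sup a`; `realisable_iff_sqPositive` — realisability ⇔
  normalised square-positivity.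

So "moment matrices PSD + normalisation" is EXACTLY realisability, in finite and infinite volume
alike. Proof: `SquareSmoothing` → `SquarePositiveFunctionals` → `SquarePositiveRealisable`
(approximate identity of polynomial squares on the compact group `ι → G`, Haar averaging inside
finite-dimensional translation-stable subspaces, Hahn–Banach, Riesz–Markov–Kakutani).

References: P. Anderson, M. Kruczenski, Nucl. Phys. B 921 (2017) §2; V. Kazakov, Z. Zheng,
arXiv:2203.11360 §2; Z. Li, S. Zhou, arXiv:2404.17071 §2 (positivity constraints of the lattice
bootstrap); Berg–Christensen–Ressel (1984) §4.2. Folklore.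
-/

noncomputable section

open MeasureTheory Filter Topology
open Literature.MathematicalPhysics.QuantumFieldTheory (haarProbability LatticeRep)

namespace Summit.QuantumFields.GaugeBoot

variable {ι : Type*} [DecidableEq ι] [Countable ι] {G : Type*} [Group G] [TopologicalSpace G]
  [IsTopologicalGroup G] [CompactSpace G] [MeasurableSpace G] [BorelSpace G]
  [SecondCountableTopology G] (r : LatticeRep G)

omit [Countable ι] [CompactSpace G] [MeasurableSpace G] [BorelSpace G] [SecondCountableTopology G] in
/-- ★ **The polynomial observables are translation finite**: every polynomial lies in a finitely
generated subspace of polynomials stable under all two-sided translations `U ↦ z⁻¹ U w` of the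
configuration group `ι → G` (an action of local linear form `U_e ↦ (z_e)⁻¹ U_e w_e`). [folklore] -/
theorem isTranslationFinite_polyAlgebra : IsTranslationFinite (polyAlgebra (ι := ι) r) :=
  fun _ hf => exists_fg_invariant_of_mem_polyAlgebra r continuous_transAct
    (exists_fg_invariant_of_local r continuous_transAct (fun h e => (h.1 e)⁻¹) (fun h e => h.2 e)
      fun _ _ _ => rfl) hf

/-! ## Bounds and positivity on polynomial observables -/

/-- ★★ **`inf a ≤ φ a`** for a normalised square-positive functional and a polynomial observable
`a`. [folklore] -/
theorem le_of_sqPositive_poly {φ : C(ι → G, ℝ) →ₗ[ℝ] ℝ} (h1 : φ 1 = 1)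
    (hpos : ∀ a ∈ polyAlgebra (ι := ι) r, 0 ≤ φ (a * a)) {a : C(ι → G, ℝ)}
    (ha : a ∈ polyAlgebra (ι := ι) r) {c : ℝ} (hc : ∀ U, c ≤ a U) : c ≤ φ a := by
  haveI : T2Space G := T2Space.of_injective_continuous r.injective r.continuous
  exact le_of_sqPositive (isTranslationFinite_polyAlgebra r) (mem_closure_polyAlgebra r) h1 hpos ha hc

/-- ★★ **`φ a ≤ sup a`.** [folklore] -/
theorem sqPositive_poly_le {φ : C(ι → G, ℝ) →ₗ[ℝ] ℝ} (h1 : φ 1 = 1)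
    (hpos : ∀ a ∈ polyAlgebra (ι := ι) r, 0 ≤ φ (a * a)) {a : C(ι → G, ℝ)}
    (ha : a ∈ polyAlgebra (ι := ι) r) {c : ℝ} (hc : ∀ U, a U ≤ c) : φ a ≤ c := by
  haveI : T2Space G := T2Space.of_injective_continuous r.injective r.continuous
  exact sqPositive_le (isTranslationFinite_polyAlgebra r) (mem_closure_polyAlgebra r) h1 hpos ha hc

/-- ★★ **Automatic continuity**: `|φ a| ≤ ‖a‖_∞` on polynomial observables. [folklore] -/
theorem abs_le_norm_of_sqPositive_poly {φ : C(ι → G, ℝ) →ₗ[ℝ] ℝ} (h1 : φ 1 = 1)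
    (hpos : ∀ a ∈ polyAlgebra (ι := ι) r, 0 ≤ φ (a * a)) {a : C(ι → G, ℝ)}
    (ha : a ∈ polyAlgebra (ι := ι) r) : |φ a| ≤ ‖a‖ := by
  haveI : T2Space G := T2Space.of_injective_continuous r.injective r.continuous
  exact abs_le_norm_of_sqPositive (isTranslationFinite_polyAlgebra r) (mem_closure_polyAlgebra r)
    h1 hpos ha

/-- ★★ **Positivity**: a pointwise non-negative polynomial observable has `0 ≤ φ a`. [folklore] -/
theorem nonneg_of_sqPositive_poly {φ : C(ι → G, ℝ) →ₗ[ℝ] ℝ} (h1 : φ 1 = 1)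
    (hpos : ∀ a ∈ polyAlgebra (ι := ι) r, 0 ≤ φ (a * a)) {a : C(ι → G, ℝ)}
    (ha : a ∈ polyAlgebra (ι := ι) r) (ha0 : ∀ U, 0 ≤ a U) : 0 ≤ φ a :=
  le_of_sqPositive_poly r h1 hpos ha ha0

/-! ## Realisability -/

/-- ★★★ **Positivity ⇒ realisability.** A linear functional on the observables of `ι → G` which
is normalised and square-positive on the polynomial observables agrees on every polynomial
observable with a Borel probability measure on the configurations. [folklore] -/
theorem exists_probabilityMeasure_of_sqPositive_poly {φ : C(ι → G, ℝ) →ₗ[ℝ] ℝ} (h1 : φ 1 = 1)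
    (hpos : ∀ a ∈ polyAlgebra (ι := ι) r, 0 ≤ φ (a * a)) :
    ∃ μ : Measure (ι → G), IsProbabilityMeasure μ ∧
      ∀ a ∈ polyAlgebra (ι := ι) r, ∫ U, a U ∂μ = φ a := by
  haveI : T2Space G := T2Space.of_injective_continuous r.injective r.continuous
  exact exists_probabilityMeasure_of_sqPositive (isTranslationFinite_polyAlgebra r)
    (mem_closure_polyAlgebra r) h1 hpos

omit [DecidableEq ι] [IsTopologicalGroup G] in
/-- **Uniqueness of the realising measure**: two finite measures with the same polynomial moments
are equal. [folklore] -/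
theorem eq_of_forall_integral_poly_eq (μ ν : Measure (ι → G)) [IsFiniteMeasure μ]
    [IsFiniteMeasure ν] (h : ∀ a ∈ polyAlgebra (ι := ι) r, ∫ U, a U ∂μ = ∫ U, a U ∂ν) : μ = ν := by
  haveI : T2Space G := T2Space.of_injective_continuous r.injective r.continuous
  exact measure_eq_of_forall_integral_eq_of_dense (mem_closure_polyAlgebra r) μ ν h

/-- ★★★ **The same for a functional given only on the polynomial observables** (bootstrap data are
values on polynomials; any such functional extends linearly to `C(ι → G, ℝ)`). [folklore] -/
theorem exists_probabilityMeasure_of_sqPositive_poly_sub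
    (φ : Subalgebra.toSubmodule (polyAlgebra (ι := ι) r) →ₗ[ℝ] ℝ)
    (h1 : φ ⟨1, (polyAlgebra (ι := ι) r).one_mem⟩ = 1)
    (hpos : ∀ (a : C(ι → G, ℝ)) (ha : a ∈ polyAlgebra (ι := ι) r),
      0 ≤ φ ⟨a * a, (polyAlgebra (ι := ι) r).mul_mem ha ha⟩) :
    ∃ μ : Measure (ι → G), IsProbabilityMeasure μ ∧
      ∀ (a : C(ι → G, ℝ)) (ha : a ∈ polyAlgebra (ι := ι) r), ∫ U, a U ∂μ = φ ⟨a, ha⟩ := by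
  obtain ⟨ψ, hψ⟩ := LinearMap.exists_extend φ
  have hψa : ∀ (a : C(ι → G, ℝ)) (ha : a ∈ polyAlgebra (ι := ι) r), ψ a = φ ⟨a, ha⟩ := fun a ha => by
    have h := LinearMap.congr_fun hψ ⟨a, ha⟩
    simpa using h
  obtain ⟨μ, hμ, hμA⟩ := exists_probabilityMeasure_of_sqPositive_poly r (φ := ψ)
    (by rw [hψa 1 (polyAlgebra (ι := ι) r).one_mem]; exact h1)
    (fun a ha => by rw [hψa _ ((polyAlgebra (ι := ι) r).mul_mem ha ha)]; exact hpos a ha)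
  exact ⟨μ, hμ, fun a ha => by rw [hμA a ha, hψa]⟩

omit [DecidableEq ι] [Countable ι] [Group G] [IsTopologicalGroup G] [CompactSpace G] [BorelSpace G]
  [SecondCountableTopology G] in
/-- **Converse (trivial)**: the expectation functional of a probability measure is normalised and
square-positive. [folklore] -/
theorem sqPositive_of_measure (μ : Measure (ι → G)) [IsProbabilityMeasure μ] :
    (∫ U, (1 : C(ι → G, ℝ)) U ∂μ = 1) ∧
      ∀ a : C(ι → G, ℝ), 0 ≤ ∫ U, (a * a) U ∂μ := by
  refine ⟨by simp, fun a => integral_nonneg fun U => ?_⟩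
  simpa using mul_self_nonneg (a U)

/-- ★★★ **Realisability ⇔ normalised square-positivity** for a linear functional on the
observables, tested on the polynomial observables. [folklore] -/
theorem realisable_iff_sqPositive (φ : C(ι → G, ℝ) →ₗ[ℝ] ℝ) :
    (∃ μ : Measure (ι → G), IsProbabilityMeasure μ ∧
        ∀ a ∈ polyAlgebra (ι := ι) r, ∫ U, a U ∂μ = φ a) ↔
      φ 1 = 1 ∧ ∀ a ∈ polyAlgebra (ι := ι) r, 0 ≤ φ (a * a) := by
  constructor
  · rintro ⟨μ, hμ, hμA⟩
    refine ⟨?_, fun a ha => ?_⟩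
    · rw [← hμA 1 (polyAlgebra (ι := ι) r).one_mem]
      simp
    · rw [← hμA _ ((polyAlgebra (ι := ι) r).mul_mem ha ha)]
      exact integral_nonneg fun U => by simpa using mul_self_nonneg (a U)
  · rintro ⟨h1, hpos⟩
    exact exists_probabilityMeasure_of_sqPositive_poly r h1 hpos

end Summit.QuantumFields.GaugeBoot

end
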